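import Mathlib
import HarnessLib

/-!
# Continuous Fekete lemma for a quasi-superadditive non-negative function
(helper for crux `CoercivePulse.AbelRegularity`, item stmt-AtomisticToContinuum-15384; pure real analysis)

If `V ≥ 0` on `[0,∞)` and `V(s) + V(t) ≤ V(s+t) + K` for `s, t ≥ 0` (superadditivity up to a CAGE BUDGET `K`, the
hypothesis of `CageBudgetFekete.QuasiSuperadditiveHeatVariance`), then the slope `V(t)/t` converges in `ℝ` or tends to
`+∞` as `t → ∞` (it tends to `sup_{t>0} (V(t) - K)/t ∈ (-∞, +∞]`). No continuity or measurability is needed: the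
non-negativity of `V` replaces the usual local boundedness in Fekete's argument.

* `superadditive_iterate` — `n·W(t₀) + W(r) ≤ W(n t₀ + r)` for superadditive `W` on `[0,∞)`.
* `slope_lower_bound` — `(V(t₀) - K)/t₀ - |V(t₀) - K|/t ≤ V(t)/t` for `0 < t₀ ≤ t` (Euclidean division `t = n t₀ + r`).
* `slope_dichotomy_of_quasiSuperadditive` — the dichotomy.
-/

noncomputable section

namespace Summit.AtomisticToContinuum.FouriersLaw.Theorems.AbelRegularity.Sketch

open Filter Set
open scoped Topology

/-- Iterated superadditivity on `[0,∞)`: `n·W(t₀) + W(r) ≤ W(n t₀ + r)`. [folklore] -/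
theorem superadditive_iterate {W : ℝ → ℝ} (hW : ∀ s t : ℝ, 0 ≤ s → 0 ≤ t → W s + W t ≤ W (s + t))
    {t₀ r : ℝ} (ht₀ : 0 ≤ t₀) (hr : 0 ≤ r) : ∀ n : ℕ, (n : ℝ) * W t₀ + W r ≤ W (n * t₀ + r) := by
  intro n
  induction n with
  | zero => simp
  | succ n ih =>
    have hnt : 0 ≤ (n : ℝ) * t₀ + r := by positivity
    have h := hW t₀ ((n : ℝ) * t₀ + r) ht₀ hnt
    have e : t₀ + ((n : ℝ) * t₀ + r) = ((n : ℝ) + 1) * t₀ + r := by ring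
    rw [e] at h
    push_cast
    linarith

/-- **Fekete lower bound.** For `V ≥ 0` on `[0,∞)` superadditive up to `K` and `0 < t₀ ≤ t`:
`(V(t₀) - K)/t₀ - |V(t₀) - K|/t ≤ V(t)/t`. [folklore] -/
theorem slope_lower_bound {V : ℝ → ℝ} {K : ℝ} (hV0 : ∀ t : ℝ, 0 ≤ t → 0 ≤ V t)
    (hQ : ∀ s t : ℝ, 0 ≤ s → 0 ≤ t → V s + V t ≤ V (s + t) + K)
    {t₀ : ℝ} (ht₀ : 0 < t₀) {t : ℝ} (ht : t₀ ≤ t) :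
    (V t₀ - K) / t₀ - |V t₀ - K| / t ≤ V t / t := by
  set W : ℝ → ℝ := fun s => V s - K with hWdef
  have hW : ∀ s t : ℝ, 0 ≤ s → 0 ≤ t → W s + W t ≤ W (s + t) := fun s u hs hu => by
    simp only [hWdef]
    linarith [hQ s u hs hu]
  have ht0 : 0 < t := ht₀.trans_le ht
  set n : ℕ := ⌊t / t₀⌋₊ with hn
  have hdiv0 : 0 ≤ t / t₀ := by positivity
  have hn1 : (n : ℝ) ≤ t / t₀ := Nat.floor_le hdiv0
  have hn2 : t / t₀ < n + 1 := Nat.lt_floor_add_one _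
  have hn1' : (n : ℝ) * t₀ ≤ t := by
    have h := mul_le_mul_of_nonneg_right hn1 ht₀.le
    rwa [div_mul_cancel₀ _ ht₀.ne'] at h
  set r : ℝ := t - n * t₀ with hr
  have hr0 : 0 ≤ r := by rw [hr]; linarith
  have hiter := superadditive_iterate hW ht₀.le hr0 n
  have hnt : (n : ℝ) * t₀ + r = t := by rw [hr]; ring
  rw [hnt] at hiter
  have hWr : -K ≤ W r := by
    show -K ≤ V r - K
    linarith [hV0 r hr0]
  have hWt : W t = V t - K := rfl
  have hVt : (n : ℝ) * W t₀ ≤ V t := by linarith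
  have key : (V t₀ - K) / t₀ - |V t₀ - K| / t ≤ (n : ℝ) * W t₀ / t := by
    have hWt₀ : W t₀ = V t₀ - K := rfl
    rw [← hWt₀, le_div_iff₀ ht0]
    have e : (W t₀ / t₀ - |W t₀| / t) * t = W t₀ * (t / t₀) - |W t₀| := by
      field_simp
    rw [e]
    rcases le_or_gt 0 (W t₀) with h0 | h0
    · rw [abs_of_nonneg h0]
      nlinarith [hn2, h0]
    · rw [abs_of_neg h0]
      nlinarith [hn1, h0]
  exact key.trans (div_le_div_of_nonneg_right hVt ht0.le)

/-- **Continuous Fekete dichotomy.** If `V ≥ 0` on `[0,∞)` and `V(s) + V(t) ≤ V(s+t) + K` for all `s, t ≥ 0`, then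
`V(t)/t` converges in `ℝ` (to `sup_{t>0}(V(t) - K)/t` when this is finite) or tends to `+∞` as `t → ∞`. [folklore] -/
theorem slope_dichotomy_of_quasiSuperadditive {V : ℝ → ℝ} {K : ℝ} (hV0 : ∀ t : ℝ, 0 ≤ t → 0 ≤ V t)
    (hQ : ∀ s t : ℝ, 0 ≤ s → 0 ≤ t → V s + V t ≤ V (s + t) + K) :
    (∃ ℓ : ℝ, Tendsto (fun t : ℝ => V t / t) atTop (𝓝 ℓ)) ∨ Tendsto (fun t : ℝ => V t / t) atTop atTop := by
  set S : Set ℝ := (fun t₀ : ℝ => (V t₀ - K) / t₀) '' Ioi 0 with hS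
  have hSne : S.Nonempty := ⟨_, 1, mem_Ioi.2 one_pos, rfl⟩
  by_cases hbdd : BddAbove S
  · left
    refine ⟨sSup S, ?_⟩
    rw [Metric.tendsto_atTop]
    intro ε hε
    obtain ⟨x, ⟨t₀, ht₀, rfl⟩, hx⟩ := exists_lt_of_lt_csSup hSne (sub_lt_self (sSup S) (half_pos hε))
    have ht₀' : 0 < t₀ := ht₀
    set B : ℝ := |V t₀ - K| + |K| with hB
    have hB0 : 0 ≤ B := by positivity
    refine ⟨max t₀ (2 * B / ε + 1), fun t ht => ?_⟩
    have ht₀t : t₀ ≤ t := le_trans (le_max_left _ _) ht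
    have ht1 : 2 * B / ε + 1 ≤ t := le_trans (le_max_right _ _) ht
    have ht0 : 0 < t := ht₀'.trans_le ht₀t
    have hBt : B < ε / 2 * t := by
      have h1 : 2 * B / ε < t := by linarith
      rw [div_lt_iff₀ hε] at h1
      linarith
    have hlow := slope_lower_bound hV0 hQ ht₀' ht₀t
    have hup : V t / t ≤ sSup S + K / t := by
      have hmem : (V t - K) / t ∈ S := ⟨t, ht0, rfl⟩
      have h1 := le_csSup hbdd hmem
      have e : V t / t = (V t - K) / t + K / t := by
        field_simp
        ring
      rw [e]
      linarith
    have h1 : |V t₀ - K| / t < ε / 2 := by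
      rw [div_lt_iff₀ ht0]
      linarith [abs_nonneg K]
    have h2 : K / t < ε / 2 := by
      rw [div_lt_iff₀ ht0]
      linarith [le_abs_self K, abs_nonneg (V t₀ - K)]
    rw [Real.dist_eq, abs_lt]
    constructor <;> linarith
  · right
    rw [tendsto_atTop]
    intro R
    obtain ⟨x, ⟨t₀, ht₀, rfl⟩, hx⟩ := not_bddAbove_iff.1 hbdd (R + 1)
    have ht₀' : 0 < t₀ := ht₀
    rw [eventually_atTop]
    refine ⟨max t₀ (|V t₀ - K| + 1), fun t ht => ?_⟩
    have ht₀t : t₀ ≤ t := le_trans (le_max_left _ _) ht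
    have ht1 : |V t₀ - K| + 1 ≤ t := le_trans (le_max_right _ _) ht
    have ht0 : 0 < t := ht₀'.trans_le ht₀t
    have hlow := slope_lower_bound hV0 hQ ht₀' ht₀t
    have h1 : |V t₀ - K| / t ≤ 1 := by
      rw [div_le_one ht0]
      linarith
    linarith

end Summit.AtomisticToContinuum.FouriersLaw.Theorems.AbelRegularity.Sketch

end
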